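import Summits.NavierStokesRegularity.NavierStokesRegularity.Theorems.EulerZoomLiouvillePowerGaugeEulerLiouvilleLogtimeBreatherExpanding
import Summits.NavierStokesRegularity.NavierStokesRegularity.Theorems.EulerZoomLiouvillePowerGaugeEulerLiouvilleClockRigidity

/-!
# Crux `EulerZoomLiouville.PowerGaugeEulerLiouville` (stmt-NavierStokesRegularity-19832), line `logtime-breathers` (T2/T3):
# profile data of a CLASSICAL log-time breather — profile equation, `A`-growth, the weak gradient in profile variables, `E`-growth

Width seat `ns-ezl-w4` (breather rigidity, file III: the profile, its equation, the slice pressures, `A`-growth).  A classical Euler pair `(u, p)` on `(−∞,0) × ℝ³` with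
`u(τ, y) = e^{cτ} V(e^{−cτ} y)` for all `τ < 0` (any real `c`) has, in the profile variable `z = e^{−cτ} y`:

* `profile_eq`, `contDiff_profile`, `isDivFree_profile` — `V = e^{−cτ} u(τ, e^{cτ}·)` is smooth and divergence free;
* `profile_equation` — for EVERY `τ < 0`: `c V − c (z·∇)V + (V·∇)V + ∇P_τ = 0` with the slice pressure
  `P_τ(z) = e^{−2cτ} p(τ, e^{cτ} z)` (`ClockRigidity.profile_identity` with `θ = ℓ = e^{cτ}`): the generalised profile equation
  `(α, β) = (c, −c)` of `ClassicalProfile.*`;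
* `lintegral_ball_profile_le` — the `A`-gauge `a^{2ρ} A(a) ≤ c₀` (`ρ ≥ 0`) gives `∫_{B_L}|V|² ≤ e^{(4+2ρ)|c|} c₀ L^{1−2ρ}` for ALL `L > 0`
  (slices `τ → 0⁻`);
* `ae_slice_gradient_eq` — a weak spatial gradient `H` of `u` on the slab is `∇V(e^{−cτ}·)` a.e., for a.e. `τ < 0`
  (slices of weak gradients + uniqueness `HasWeakFDerivOn.unique_holds` against the classical gradient);
* `profile_gradient_growth_of_gaugeE` — the `E`-gauge `a^{ρ} E(a) ≤ c₀` gives `∫_{B_L}|∇V|²_F ≤ C L^{1−ρ}` for `L ≥ 2`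
  (window `(−2,−1) × B_a ⊆ Q_a`, `a = e^{2|c|} L`, Tonelli, slice dilation; the template is
  `Past.profile_gradient_growth_of_gaugeE_past`).

WHAT THIS IS NOT: not NS regularity, not the crux — data bricks for the breather-rigidity member; `--supports` stmt-19832. [folklore]
-/

noncomputable section

set_option linter.dupNamespace false

open MeasureTheory Set Filter Topology Metric Function TopologicalSpace
open scoped ENNReal NNReal RealInnerProductSpace ContDiff

namespace Summit.NavierStokesRegularity.NavierStokesRegularity.Theorems.PowerGaugeEulerLiouville

open Literature.Analysis Literature.Analysis.FunctionSpaces Literature.Analysis.FluidPDE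

namespace BreatherRigidity

variable {u : ℝ → EuclideanSpace ℝ (Fin 3) → EuclideanSpace ℝ (Fin 3)} {p : ℝ → EuclideanSpace ℝ (Fin 3) → ℝ}
  {H : ℝ → EuclideanSpace ℝ (Fin 3) → EuclideanSpace ℝ (Fin 3) →L[ℝ] EuclideanSpace ℝ (Fin 3)}
  {c : ℝ} {V : EuclideanSpace ℝ (Fin 3) → EuclideanSpace ℝ (Fin 3)}

/-! ### The profile -/

/-- The profile of a breather in terms of any slice: `V = e^{−cτ} u(τ, e^{cτ}·)`. [folklore] -/
theorem profile_eq
    (hbr : ∀ τ : ℝ, τ < 0 → ∀ y, u τ y = Real.exp (c * τ) • V (Real.exp (-(c * τ)) • y))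
    {τ : ℝ} (hτ : τ < 0) :
    V = fun z => Real.exp (-(c * τ)) • u τ (Real.exp (c * τ) • z) := by
  funext z
  rw [hbr τ hτ, smul_smul, smul_smul, ← Real.exp_add, neg_add_cancel, Real.exp_zero, one_smul, one_smul]

/-- The profile of a classical breather is smooth. [folklore] -/
theorem contDiff_profile (hcl : IsClassicalEulerSolutionOn (Iio 0) 0 u p)
    (hbr : ∀ τ : ℝ, τ < 0 → ∀ y, u τ y = Real.exp (c * τ) • V (Real.exp (-(c * τ)) • y)) :
    ContDiff ℝ ∞ V := by
  rw [profile_eq hbr (by norm_num : (-1 : ℝ) < 0)]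
  exact ((hcl.contDiff_velocity (by norm_num : (-1 : ℝ) < 0)).comp (contDiff_const_smul _)).const_smul _

/-- The profile of a classical breather is divergence free. [folklore] -/
theorem isDivFree_profile (hcl : IsClassicalEulerSolutionOn (Iio 0) 0 u p)
    (hbr : ∀ τ : ℝ, τ < 0 → ∀ y, u τ y = Real.exp (c * τ) • V (Real.exp (-(c * τ)) • y)) :
    VectorCalculus.IsDivFree V := by
  have h1 : (-1 : ℝ) ∈ Iio 0 := by norm_num
  rw [profile_eq hbr (by norm_num : (-1 : ℝ) < 0)]
  have hd : Differentiable ℝ (u (-1)) := (hcl.contDiff_velocity h1).differentiable (by simp)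
  have hud : Differentiable ℝ (fun z : EuclideanSpace ℝ (Fin 3) => u (-1) (Real.exp (c * (-1)) • z)) := by fun_prop
  have hdiv : VectorCalculus.IsDivFree (fun z : EuclideanSpace ℝ (Fin 3) => u (-1) (Real.exp (c * (-1)) • z)) :=
    (hcl.divFree (-1) h1).comp_smul _
  exact VectorCalculus.IsDivFree.const_smul hud hdiv _

/-- The slice derivative of a breather: `D(u(τ))(y) = DV(e^{−cτ} y)`. [folklore] -/
theorem hasFDerivAt_slice (hVd : Differentiable ℝ V)
    (hbr : ∀ τ : ℝ, τ < 0 → ∀ y, u τ y = Real.exp (c * τ) • V (Real.exp (-(c * τ)) • y))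
    {τ : ℝ} (hτ : τ < 0) (y : EuclideanSpace ℝ (Fin 3)) :
    HasFDerivAt (u τ) (fderiv ℝ V (Real.exp (-(c * τ)) • y)) y := by
  -- adapted from `LogtimeBreather.ae_eq_zero_of_gauge_of_tameBreather` (…LogtimeBreatherTame)
  have hus : u τ = fun y => Real.exp (c * τ) • V (Real.exp (-(c * τ)) • y) := funext (hbr τ hτ)
  rw [hus]
  have h1 : HasFDerivAt (fun y : EuclideanSpace ℝ (Fin 3) => Real.exp (-(c * τ)) • y)
      (Real.exp (-(c * τ)) • ContinuousLinearMap.id ℝ (EuclideanSpace ℝ (Fin 3))) y :=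
    (ContinuousLinearMap.id ℝ (EuclideanSpace ℝ (Fin 3))).hasFDerivAt.const_smul (Real.exp (-(c * τ)))
  have h2 := ((hVd (Real.exp (-(c * τ)) • y)).hasFDerivAt.comp y h1).const_smul (Real.exp (c * τ))
  refine h2.congr_fderiv ?_
  ext v
  simp only [FunLike.coe_smul, Pi.smul_apply, ContinuousLinearMap.comp_apply, ContinuousLinearMap.id_apply,
    map_smul, smul_smul, ← Real.exp_add, add_neg_cancel, Real.exp_zero, one_smul]

/-! ### The profile equation -/

/-- **THE BREATHER PROFILE EQUATION** (generalised profile equation with `(α, β) = (c, −c)`).  For a classical Euler pair with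
`u(τ, y) = e^{cτ} V(e^{−cτ} y)` (`τ < 0`) and every `τ < 0`:
`c V(z) − c DV(z)[z] + DV(z)[V z] + ∇P_τ(z) = 0`, `P_τ(y) = (e^{cτ})^{−2} p(τ, e^{cτ} y)`
(`ClockRigidity.profile_identity` with `θ = ℓ = e^{cτ}`: `θ'ℓ/θ² = c`, `−ℓ'/θ = −c`). [folklore] -/
theorem profile_equation (hcl : IsClassicalEulerSolutionOn (Iio 0) 0 u p)
    (hbr : ∀ τ : ℝ, τ < 0 → ∀ y, u τ y = Real.exp (c * τ) • V (Real.exp (-(c * τ)) • y))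
    {τ : ℝ} (hτ : τ < 0) (z : EuclideanSpace ℝ (Fin 3)) :
    c • V z + (-c) • fderiv ℝ V z z + fderiv ℝ V z (V z) +
      gradient (fun y => (Real.exp (c * τ) ^ 2)⁻¹ * p τ (Real.exp (c * τ) • y)) z = 0 := by
  have hVd : Differentiable ℝ V := (contDiff_profile hcl hbr).differentiable (by simp)
  set θ : ℝ → ℝ := fun s => Real.exp (c * s) with hθ
  have hpos : ∀ s : ℝ, s < 0 → 0 < θ s ∧ 0 < θ s := fun s _ => ⟨Real.exp_pos _, Real.exp_pos _⟩
  have hθD : ∀ s : ℝ, HasDerivAt θ (Real.exp (c * s) * (c * 1)) s := fun s =>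
    ((hasDerivAt_id s).const_mul c).exp
  have hθd : DifferentiableOn ℝ θ (Iio 0) := fun s _ => (hθD s).differentiableAt.differentiableWithinAt
  have hu : ∀ s : ℝ, s < 0 → ∀ y, u s y = θ s • V ((θ s)⁻¹ • y) := by
    intro s hs y
    rw [hbr s hs y, hθ, Real.exp_neg]
  have h := ClockRigidity.profile_identity hcl hpos hθd hθd hu hVd hτ z
  have hE : 0 < Real.exp (c * τ) := Real.exp_pos _
  have hder : deriv θ τ = c * Real.exp (c * τ) := by rw [(hθD τ).deriv]; ring
  have c1 : deriv θ τ * θ τ / θ τ ^ 2 = c := by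
    rw [hder, hθ]; field_simp
  have c2 : -(deriv θ τ / θ τ) = -c := by
    rw [hder, hθ]; field_simp
  rw [c1, c2] at h
  -- the pressure gradient: `∇((−E⁻²) p(τ, E·)) = −∇(E⁻² p(τ, E·))`
  have hpd : DifferentiableAt ℝ (fun y => p τ (Real.exp (c * τ) • y)) z :=
    (((hcl.contDiff_pressure hτ).differentiable (by simp)).differentiableAt).comp z
      ((differentiableAt_id).const_smul (Real.exp (c * τ)))
  have hg1 : gradient (fun y => (-(θ τ ^ 2)⁻¹) * p τ (θ τ • y)) z =
      (-(Real.exp (c * τ) ^ 2)⁻¹) • gradient (fun y => p τ (Real.exp (c * τ) • y)) z :=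
    ClockRigidity.gradient_const_mul' hpd _
  have hg2 : gradient (fun y => (Real.exp (c * τ) ^ 2)⁻¹ * p τ (Real.exp (c * τ) • y)) z =
      (Real.exp (c * τ) ^ 2)⁻¹ • gradient (fun y => p τ (Real.exp (c * τ) • y)) z :=
    ClockRigidity.gradient_const_mul' hpd _
  rw [hg1] at h
  rw [hg2, h, neg_smul, neg_add_cancel]

/-- The slice pressures `P_τ(y) = (e^{cτ})^{−2} p(τ, e^{cτ} y)` of a classical breather are smooth (`τ < 0`). [folklore] -/
theorem contDiff_slicePressure (hcl : IsClassicalEulerSolutionOn (Iio 0) 0 u p) {τ : ℝ} (hτ : τ < 0) :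
    ContDiff ℝ ∞ (fun y => (Real.exp (c * τ) ^ 2)⁻¹ * p τ (Real.exp (c * τ) • y)) :=
  contDiff_const.mul ((hcl.contDiff_pressure hτ).comp (contDiff_const_smul _))

/-- **The slice pressures differ by constants**: `P_τ(z) − P_{τ'}(z) = P_τ(0) − P_{τ'}(0)` for all `τ, τ' < 0` and `z`
(both have the gradient `−(cV − c(z·∇)V + (V·∇)V)`, which does not depend on the slice). [folklore] -/
theorem slicePressure_sub_eq (hcl : IsClassicalEulerSolutionOn (Iio 0) 0 u p)
    (hbr : ∀ τ : ℝ, τ < 0 → ∀ y, u τ y = Real.exp (c * τ) • V (Real.exp (-(c * τ)) • y))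
    {τ τ' : ℝ} (hτ : τ < 0) (hτ' : τ' < 0) (z : EuclideanSpace ℝ (Fin 3)) :
    (Real.exp (c * τ) ^ 2)⁻¹ * p τ (Real.exp (c * τ) • z) - (Real.exp (c * τ') ^ 2)⁻¹ * p τ' (Real.exp (c * τ') • z) =
      (Real.exp (c * τ) ^ 2)⁻¹ * p τ (Real.exp (c * τ) • 0) - (Real.exp (c * τ') ^ 2)⁻¹ * p τ' (Real.exp (c * τ') • 0) := by
  set f : EuclideanSpace ℝ (Fin 3) → ℝ := fun y => (Real.exp (c * τ) ^ 2)⁻¹ * p τ (Real.exp (c * τ) • y) -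
    (Real.exp (c * τ') ^ 2)⁻¹ * p τ' (Real.exp (c * τ') • y) with hf
  have hd1 : Differentiable ℝ (fun y => (Real.exp (c * τ) ^ 2)⁻¹ * p τ (Real.exp (c * τ) • y)) :=
    (contDiff_slicePressure hcl hτ).differentiable (by simp)
  have hd2 : Differentiable ℝ (fun y => (Real.exp (c * τ') ^ 2)⁻¹ * p τ' (Real.exp (c * τ') • y)) :=
    (contDiff_slicePressure hcl hτ').differentiable (by simp)
  have hfd : Differentiable ℝ f := hd1.sub hd2
  have hgrad : ∀ y, gradient f y = 0 := by
    intro y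
    have e1 := profile_equation hcl hbr hτ y
    have e2 := profile_equation hcl hbr hτ' y
    have hsub : gradient f y = gradient (fun y => (Real.exp (c * τ) ^ 2)⁻¹ * p τ (Real.exp (c * τ) • y)) y -
        gradient (fun y => (Real.exp (c * τ') ^ 2)⁻¹ * p τ' (Real.exp (c * τ') • y)) y := by
      rw [hf]
      unfold gradient
      rw [fderiv_fun_sub (hd1 y) (hd2 y), map_sub]
    rw [hsub]
    have : gradient (fun y => (Real.exp (c * τ) ^ 2)⁻¹ * p τ (Real.exp (c * τ) • y)) y =
        gradient (fun y => (Real.exp (c * τ') ^ 2)⁻¹ * p τ' (Real.exp (c * τ') • y)) y := by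
      have h1 := eq_neg_of_add_eq_zero_right e1
      have h2 := eq_neg_of_add_eq_zero_right e2
      rw [h1, h2]
    rw [this, sub_self]
  have hfderiv : ∀ y, fderiv ℝ f y = 0 := fun y => by
    rw [← toDual_gradient (𝕜 := ℝ), hgrad y, map_zero]
  exact is_const_of_fderiv_eq_zero hfd hfderiv z 0

/-! ### `A`-growth of the profile at all scales -/

/-- **`A`-gauge ⇒ profile energy growth at ALL scales.**  If `u(τ, y) = e^{cτ} V(e^{−cτ} y)` for `τ < 0` and
`a^{2ρ} A(a; 0; u) ≤ c₀` for all `a > 0` (`ρ ≥ 0`), then `∫_{B_L}‖V‖² ≤ e^{(4+2ρ)|c|} c₀ L^{1−2ρ}` for every `L > 0`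
(the slice `τ = −t`, `t = ½ min(1, L²) e^{−2|c|}`, is admissible for the radius `a = e^{−ct} L`, and
`∫_{B_L}‖V‖² = e^{5ct} ∫_{B_a}‖u(−t)‖² ≤ e^{(4+2ρ)ct} c₀ L^{1−2ρ}`). [folklore] -/
theorem lintegral_ball_profile_le {ρ : ℝ} (hρ : 0 ≤ ρ) {c₀ : ℝ≥0}
    (hA : ∀ a : ℝ, 0 < a → ENNReal.ofReal (a ^ (2 * ρ)) *
      cknA a (0 : ℝ × EuclideanSpace ℝ (Fin 3)) u ≤ (c₀ : ℝ≥0∞))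
    (hbr : ∀ τ : ℝ, τ < 0 → ∀ y, u τ y = Real.exp (c * τ) • V (Real.exp (-(c * τ)) • y))
    {L : ℝ} (hL : 0 < L) :
    ∫⁻ x in ball (0 : EuclideanSpace ℝ (Fin 3)) L, ‖V x‖ₑ ^ 2 ≤
      ENNReal.ofReal (Real.exp ((4 + 2 * ρ) * |c|)) * (c₀ : ℝ≥0∞) * ENNReal.ofReal (L ^ (1 - 2 * ρ)) := by
  -- adapted from `LogtimeBreather.lintegral_ball_profile_eq_zero_of_gaugeA` (…LogtimeBreatherExpanding)
  set J : ℝ≥0∞ := ∫⁻ x in ball (0 : EuclideanSpace ℝ (Fin 3)) L, ‖V x‖ₑ ^ 2 with hJ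
  set t : ℝ := min 1 (L ^ 2) * Real.exp (-(2 * |c|)) / 2 with ht
  have hm0 : 0 < min 1 (L ^ 2) := lt_min one_pos (by positivity)
  have he0 : 0 < Real.exp (-(2 * |c|)) := Real.exp_pos _
  have he1 : Real.exp (-(2 * |c|)) ≤ 1 := by
    rw [Real.exp_le_one_iff]; have := abs_nonneg c; linarith
  have ht0 : 0 < t := by rw [ht]; positivity
  have ht1 : t ≤ 1 := by
    rw [ht]
    have : min 1 (L ^ 2) * Real.exp (-(2 * |c|)) ≤ 1 * 1 :=
      mul_le_mul (min_le_left _ _) he1 he0.le zero_le_one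
    linarith
  have htL : t < L ^ 2 * Real.exp (-(2 * |c|)) := by
    rw [ht]
    have : min 1 (L ^ 2) * Real.exp (-(2 * |c|)) ≤ L ^ 2 * Real.exp (-(2 * |c|)) :=
      mul_le_mul_of_nonneg_right (min_le_right _ _) he0.le
    have : 0 < L ^ 2 * Real.exp (-(2 * |c|)) := by positivity
    linarith
  set τ : ℝ := -t with hτdef
  have hτ0 : τ < 0 := by rw [hτdef]; linarith
  have hcτ : |c * τ| ≤ |c| := by
    rw [abs_mul, hτdef, abs_neg, abs_of_pos ht0]
    exact mul_le_of_le_one_right (abs_nonneg c) ht1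
  -- the radius `a = e^{cτ} L`, admissible: `−a² < τ`
  set a : ℝ := Real.exp (c * τ) * L with hadef
  have ha0 : 0 < a := mul_pos (Real.exp_pos _) hL
  have hea : Real.exp (-(2 * |c|)) ≤ Real.exp (c * τ) ^ 2 := by
    rw [← Real.exp_nat_mul, Real.exp_le_exp]
    push_cast
    have := neg_abs_le (c * τ)
    linarith
  have hadm : -(a ^ 2) < τ := by
    rw [hadef, mul_pow, hτdef]
    have : L ^ 2 * Real.exp (-(2 * |c|)) ≤ Real.exp (c * τ) ^ 2 * L ^ 2 := by
      rw [mul_comm]; exact mul_le_mul_of_nonneg_right hea (by positivity)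
    linarith
  have hτI : τ ∈ Ioo ((0 : ℝ × EuclideanSpace ℝ (Fin 3)).1 - a ^ 2) (0 : ℝ × EuclideanSpace ℝ (Fin 3)).1 := by
    simp only [Prod.fst_zero, zero_sub, mem_Ioo]
    exact ⟨hadm, hτ0⟩
  -- the gauge on the slice
  have hslice : (ENNReal.ofReal a)⁻¹ * ∫⁻ x in ball (0 : EuclideanSpace ℝ (Fin 3)) a, ‖u τ x‖ₑ ^ 2 ≤
      cknA a (0 : ℝ × EuclideanSpace ℝ (Fin 3)) u := by
    unfold cknA
    exact le_iSup₂ (f := fun t (_ : t ∈ Ioo ((0 : ℝ × EuclideanSpace ℝ (Fin 3)).1 - a ^ 2)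
        (0 : ℝ × EuclideanSpace ℝ (Fin 3)).1) =>
        (ENNReal.ofReal a)⁻¹ * ∫⁻ x in ball (0 : ℝ × EuclideanSpace ℝ (Fin 3)).2 a, ‖u t x‖ₑ ^ 2) τ hτI
  set I : ℝ≥0∞ := ∫⁻ x in ball (0 : EuclideanSpace ℝ (Fin 3)) a, ‖u τ x‖ₑ ^ 2 with hI
  have hgauge : ENNReal.ofReal (a ^ (2 * ρ)) * ((ENNReal.ofReal a)⁻¹ * I) ≤ (c₀ : ℝ≥0∞) :=
    calc ENNReal.ofReal (a ^ (2 * ρ)) * ((ENNReal.ofReal a)⁻¹ * I)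
        ≤ ENNReal.ofReal (a ^ (2 * ρ)) * cknA a (0 : ℝ × EuclideanSpace ℝ (Fin 3)) u := by gcongr
      _ ≤ (c₀ : ℝ≥0∞) := hA a ha0
  have hKa : ENNReal.ofReal (a ^ (2 * ρ)) * (ENNReal.ofReal a)⁻¹ = ENNReal.ofReal (a ^ (2 * ρ - 1)) := by
    rw [← ENNReal.ofReal_inv_of_pos ha0, ← ENNReal.ofReal_mul (by positivity), Real.rpow_sub_one ha0.ne',
      div_eq_mul_inv]
  have hIle : I ≤ ENNReal.ofReal (a ^ (1 - 2 * ρ)) * (c₀ : ℝ≥0∞) := by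
    have hunit : ENNReal.ofReal (a ^ (1 - 2 * ρ)) * ENNReal.ofReal (a ^ (2 * ρ - 1)) = 1 := by
      rw [← ENNReal.ofReal_mul (by positivity), ← Real.rpow_add ha0, show (1 - 2 * ρ) + (2 * ρ - 1) = 0 by ring,
        Real.rpow_zero, ENNReal.ofReal_one]
    calc I = ENNReal.ofReal (a ^ (1 - 2 * ρ)) * (ENNReal.ofReal (a ^ (2 * ρ - 1)) * I) := by
          rw [← mul_assoc, hunit, one_mul]
      _ = ENNReal.ofReal (a ^ (1 - 2 * ρ)) * (ENNReal.ofReal (a ^ (2 * ρ)) * ((ENNReal.ofReal a)⁻¹ * I)) := by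
          rw [← mul_assoc (ENNReal.ofReal (a ^ (2 * ρ))), hKa]
      _ ≤ ENNReal.ofReal (a ^ (1 - 2 * ρ)) * (c₀ : ℝ≥0∞) := by gcongr
  -- the slice energy in profile variables: `I = e^{5cτ} J`
  have hIeq : I = ENNReal.ofReal (Real.exp (5 * (c * τ))) * J := by
    have hfun : (fun x => ‖u τ x‖ₑ ^ 2) = fun x => ‖Real.exp (c * τ) • V (Real.exp (-(c * τ)) • x)‖ₑ ^ 2 := by
      funext x; rw [hbr τ hτ0 x]
    have hrad : Real.exp (-(c * τ)) * a = L := by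
      rw [hadef, ← mul_assoc, ← Real.exp_add, neg_add_cancel, Real.exp_zero, one_mul]
    rw [hI, hfun, LogtimeBreather.lintegral_ball_enorm_sq_breatherSlice, hrad]
  -- assemble: `J = e^{−5cτ} I ≤ e^{−5cτ} a^{1−2ρ} c₀ = e^{−(4+2ρ)cτ} L^{1−2ρ} c₀`
  have hE5 : ENNReal.ofReal (Real.exp (-(5 * (c * τ)))) * ENNReal.ofReal (Real.exp (5 * (c * τ))) = 1 := by
    rw [← ENNReal.ofReal_mul (Real.exp_pos _).le, ← Real.exp_add, neg_add_cancel, Real.exp_zero, ENNReal.ofReal_one]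
  have hpow : Real.exp (-(5 * (c * τ))) * a ^ (1 - 2 * ρ) = Real.exp (-((4 + 2 * ρ) * (c * τ))) * L ^ (1 - 2 * ρ) := by
    rw [hadef, Real.mul_rpow (Real.exp_pos _).le hL.le, ← Real.exp_mul, ← mul_assoc, ← Real.exp_add]
    congr 2
    ring
  have hexp : Real.exp (-((4 + 2 * ρ) * (c * τ))) ≤ Real.exp ((4 + 2 * ρ) * |c|) := by
    rw [Real.exp_le_exp]
    have h1 : -(c * τ) ≤ |c| := (neg_le_abs _).trans hcτ
    have h2 : (0 : ℝ) ≤ 4 + 2 * ρ := by linarith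
    nlinarith
  calc J = ENNReal.ofReal (Real.exp (-(5 * (c * τ)))) * (ENNReal.ofReal (Real.exp (5 * (c * τ))) * J) := by
        rw [← mul_assoc, hE5, one_mul]
    _ = ENNReal.ofReal (Real.exp (-(5 * (c * τ)))) * I := by rw [hIeq]
    _ ≤ ENNReal.ofReal (Real.exp (-(5 * (c * τ)))) * (ENNReal.ofReal (a ^ (1 - 2 * ρ)) * (c₀ : ℝ≥0∞)) := by gcongr
    _ = ENNReal.ofReal (Real.exp (-((4 + 2 * ρ) * (c * τ)))) * ENNReal.ofReal (L ^ (1 - 2 * ρ)) * (c₀ : ℝ≥0∞) := by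
        rw [← mul_assoc, ← ENNReal.ofReal_mul (Real.exp_pos _).le, hpow, ENNReal.ofReal_mul (Real.exp_pos _).le]
    _ ≤ ENNReal.ofReal (Real.exp ((4 + 2 * ρ) * |c|)) * ENNReal.ofReal (L ^ (1 - 2 * ρ)) * (c₀ : ℝ≥0∞) :=
        mul_le_mul' (mul_le_mul' (ENNReal.ofReal_le_ofReal hexp) le_rfl) le_rfl
    _ = ENNReal.ofReal (Real.exp ((4 + 2 * ρ) * |c|)) * (c₀ : ℝ≥0∞) * ENNReal.ofReal (L ^ (1 - 2 * ρ)) := by ring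

end BreatherRigidity

end Summit.NavierStokesRegularity.NavierStokesRegularity.Theorems.PowerGaugeEulerLiouville

end
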